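import Summits.ValiantsHypothesis.ValiantsHypothesis.Theorems.VPBoundarySquareNbTruncation
import HarnessLib

/-!
# VP boundary square — `NF_ℂ ⟹ B_nb`, hence `B_nb ≡ U_ε^Σ ≡ NF_ℂ` as ONE typed open statement
(decomp-valiant lens 3, O-L3-14 sequel S3, FILE 2/2)

FILE S3b. The route's banked aside `B_nb := VNPnbPFamSubsetVNP ℂ` (item 23487; Bürgisser 2024,
Thm. 4.10 (2): "every `VNPnb^ℂ` p-family is in `VNP^ℂ`", printed under GRH) has so far two typed
companions: FILE `…NbCollapseIff` derived from it the NORMAL FORM `NF_ℂ` of Cor. 4.7 over `ℂ`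
(every `VNPnb^ℂ` family is a power substitution `z ↦ X_{v z}^{2^{ℓ z}}`, `ℓ` p-bounded, of a
`VNP^ℂ` family; `nbNormalForm_of_booleanNbDefinable`), and FILE `…NbPresSigma` proved
`U_ε^Σ ≡ B_nb` (`presVNPBarSubsetVNP_iff_booleanNbDefinable`). Here the converse
`NF_ℂ ⟹ B_nb` (`booleanNbDefinable_of_nbNormalForm`), which is Bürgisser's own one-paragraph
argument for Thm. 4.8 "⇐"/Cor. 4.7 ⇒ Thm. 4.10 read over `ℂ` with `NF_ℂ` as the hypothesis:
given a `VNPnb^ℂ` p-family `f = g(X_{v z}^{2^{ℓ z}})`, `g ∈ VNP`, DROP the heavy substitutions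
(`2^{ℓ z} > deg f ↦ 0`: `truncSum_aeval_light` — they only produce monomials of degree `> deg f`),
so that `f` is the degree-`≤ deg f` truncation of `g(θ)` with `θ` of p-bounded size
(`L(X^{2^ℓ}) ≤ ℓ`) AND p-bounded degree; `g(θ) ∈ VNP` (`isVNPFamily_aeval`, FILE S3a) and `VNP`
is closed under p-bounded truncation (`isVNPFamily_truncate`, FILE S3a = Prop. 3.1). Hence

* `nbNormalForm_iff_booleanNbDefinable : NF_ℂ ↔ B_nb`,
* `presVNPBarSubsetVNP_iff_nbNormalForm : U_ε^Σ ↔ NF_ℂ`,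
* `nbCollapse_iff_collapse_and_nbNormalForm : (VNPnb^ℂ ⊆ VPnb^ℂ) ↔ (VP ℂ = VNP ℂ ∧ NF_ℂ)`,

i.e. the lineage's single remaining untyped debt `B_nb` now has three kernel-equivalent faces
(Boolean/`Σ`-definability `U_ε^Σ`, Bürgisser's `B_nb`, Malod–Bürgisser normal form `NF_ℂ`), and
the GRH-free skeleton of Thm. 4.10 (2) reads `VNPnb ⊆ VPnb ↔ VP = VNP ∧ NF_ℂ`.

No `def`, no `def … : Prop`, no named facts, no `sorry`.

References: [cite: Burgisser2024Completeness, Prop. 3.1, Cor. 4.7, Thm. 4.8, Rem. 4.9,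
Thm. 4.10 (2) (p0013, p0017); Malod 2007 for the `𝔽_p` normal form] [cite: Burgisser2000, §2.1]
-/

set_option linter.dupNamespace false

noncomputable section

open MvPolynomial Finset
open Literature.Computability.AlgebraicComplexity
open Summit.ValiantsHypothesis.ValiantsHypothesis.Theorems.VPBoundarySquareNbBitSplit
open Summit.ValiantsHypothesis.ValiantsHypothesis.Theorems.VPBoundarySquareNbGRHSlot
open Summit.ValiantsHypothesis.ValiantsHypothesis.Theorems.VPBoundarySquareNbCollapseIff
open Summit.ValiantsHypothesis.ValiantsHypothesis.Theorems.VPBoundarySquareNbPresSigma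
open Summit.ValiantsHypothesis.ValiantsHypothesis.Theorems.VPBoundarySquareNbTruncation

namespace Summit.ValiantsHypothesis.ValiantsHypothesis.Theorems.VPBoundarySquareNbNormalFormIff

universe u

/-! ## §1. Dropping the heavy substitutions does not change the low-degree part -/

section Light

variable {R : Type*} [CommSemiring R] {σ τ : Type*}

/-- **Light/heavy split.** Under the power substitution `z ↦ X_{v z}^{2^{ℓ z}}`, a monomial
containing a *heavy* variable (`2^{ℓ z} > d`) becomes a monomial of degree `> d`; hence the
homogeneous components of degree `≤ d` of `P(X_{v z}^{2^{ℓ z}})` agree with those of the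
*light* substitution (heavy `z ↦ 0`). [cite: Burgisser2024Completeness, §4.2, proof of Thm. 4.8 (p0017 L25–L31)] -/
theorem truncSum_aeval_light (v : σ → τ) (ℓ : σ → ℕ) (d : ℕ) (P : MvPolynomial σ R) :
    ∑ j ∈ range (d + 1), homogeneousComponent j
        (aeval (fun z => if 2 ^ ℓ z ≤ d then (X (v z) : MvPolynomial τ R) ^ 2 ^ ℓ z else 0) P) =
      ∑ j ∈ range (d + 1), homogeneousComponent j
        (aeval (fun z => (X (v z) : MvPolynomial τ R) ^ 2 ^ ℓ z) P) := by
  classical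
  refine MvPolynomial.induction_on' P (fun s c => ?_) (fun p q hp hq => ?_)
  · by_cases hs : ∀ z ∈ s.support, 2 ^ ℓ z ≤ d
    · -- light monomial: the two substitutions agree on it
      have h : aeval (fun z => if 2 ^ ℓ z ≤ d then (X (v z) : MvPolynomial τ R) ^ 2 ^ ℓ z else 0)
            (monomial s c) =
          aeval (fun z => (X (v z) : MvPolynomial τ R) ^ 2 ^ ℓ z) (monomial s c) := by
        simp only [aeval_monomial]
        congr 1
        exact Finsupp.prod_congr fun z hz => by rw [if_pos (hs z hz)]
      rw [h]
    · -- heavy monomial: light image `0`, full image homogeneous of degree `> d`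
      push Not at hs
      obtain ⟨z, hz, hlt⟩ := hs
      have hsz : s z ≠ 0 := Finsupp.mem_support_iff.mp hz
      have h0 : aeval (fun z => if 2 ^ ℓ z ≤ d then (X (v z) : MvPolynomial τ R) ^ 2 ^ ℓ z else 0)
          (monomial s c) = 0 := by
        rw [aeval_monomial, Finsupp.prod, Finset.prod_eq_zero hz, mul_zero]
        rw [if_neg (not_le.mpr hlt), zero_pow hsz]
      have hhom : (aeval (fun z => (X (v z) : MvPolynomial τ R) ^ 2 ^ ℓ z) (monomial s c)).IsHomogeneous
          (0 + ∑ z ∈ s.support, 2 ^ ℓ z * s z) := by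
        rw [aeval_monomial, algebraMap_eq, Finsupp.prod]
        exact (isHomogeneous_C _ c).mul (IsHomogeneous.prod s.support
          (fun z => ((X (v z) : MvPolynomial τ R) ^ 2 ^ ℓ z) ^ s z) (fun z => 2 ^ ℓ z * s z)
          fun z _ => by rw [← pow_mul]; exact isHomogeneous_X_pow _ _)
      have hbig : d < 0 + ∑ z ∈ s.support, 2 ^ ℓ z * s z := by
        rw [zero_add]
        exact lt_of_lt_of_le hlt ((Nat.le_mul_of_pos_right _ (Nat.pos_of_ne_zero hsz)).trans
          (Finset.single_le_sum (f := fun z => 2 ^ ℓ z * s z) (fun _ _ => Nat.zero_le _) hz))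
      rw [h0]
      simp only [map_zero, Finset.sum_const_zero]
      refine (Finset.sum_eq_zero fun j hj => ?_).symm
      rw [homogeneousComponent_of_mem (m := j) hhom, if_neg]
      have := Finset.mem_range.mp hj
      omega
  · simp only [map_add, Finset.sum_add_distrib]
    rw [hp, hq]

end Light

/-! ## §2. `NF_ℂ ⟹ B_nb` -/

/-- **T2 ⟸ (`NF_ℂ → B_nb`).** If every `VNPnb^ℂ` family is a p-bounded power substitution of a
`VNP^ℂ` family (the normal form of Bürgisser 2024 Cor. 4.7, over `ℂ`), then every `VNPnb^ℂ`
p-family is in `VNP^ℂ`: drop the heavy substitutions (`truncSum_aeval_light`), substitute the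
light ones (`isVNPFamily_aeval`: size `Σ_z ℓ z`, degree `≤ deg f`), truncate to degree `≤ deg f`
(`isVNPFamily_truncate` = Prop. 3.1). The hypothesis is VERBATIM the conclusion of
`nbNormalForm_of_booleanNbDefinable`. [cite: Burgisser2024Completeness, Prop. 3.1, Cor. 4.7, Thm. 4.8 (p0013 L17–L26, p0017 L22–L36)] -/
theorem booleanNbDefinable_of_nbNormalForm
    (hNF : ∀ (w : ℕ → ℕ) (f : ∀ n, MvPolynomial (Fin (w n)) ℂ), IsVNPnbFamily f →
      ∃ (a : ℕ → ℕ) (g : ∀ n, MvPolynomial (Fin (a n)) ℂ) (v : ∀ n, Fin (a n) → Fin (w n))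
        (ℓ : ∀ n, Fin (a n) → ℕ), IsVNPFamily g ∧ (IsPBounded fun n => Finset.univ.sup (ℓ n)) ∧
          ∀ n, f n = MvPolynomial.aeval (fun z => (X (v n z) : MvPolynomial (Fin (w n)) ℂ) ^
            2 ^ ℓ n z) (g n)) :
    VNPnbPFamSubsetVNP ℂ := by
  intro w f hpf hf
  obtain ⟨a, g, v, ℓ, hg, hℓ, hfg⟩ := hNF w f hf
  obtain ⟨hw, hdeg⟩ := hpf
  have ha : IsPBounded a := hg.1.1.mono fun n => by simp
  -- the light substitution `θ`: heavy variables (`2^{ℓ z} > deg f_n`) go to `0`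
  let θ : ∀ n, Fin (a n) → MvPolynomial (Fin (w n)) ℂ := fun n z =>
    if 2 ^ ℓ n z ≤ (f n).totalDegree then (X (v n z) : MvPolynomial (Fin (w n)) ℂ) ^ 2 ^ ℓ n z
    else 0
  have hF : IsVNPFamily fun n => aeval (θ n) (g n) := by
    refine isVNPFamily_aeval hg θ hw ((IsPBounded.mul_holds ha hℓ).mono fun n => ?_) hdeg
      (fun n z => ?_)
    · -- `Σ_z L(θ_z) ≤ a_n · max_z ℓ z`
      calc ∑ z, complexity (θ n z) ≤ ∑ _z : Fin (a n), Finset.univ.sup (ℓ n) :=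
            Finset.sum_le_sum fun z _ => by
              dsimp only [θ]
              split_ifs
              · exact (complexity_X_pow_two_pow_le _ _).trans (Finset.le_sup (Finset.mem_univ z))
              · rw [← C_0, complexity_C_holds]
                exact Nat.zero_le _
        _ = a n * Finset.univ.sup (ℓ n) := by simp
    · -- `deg θ_z ≤ deg f_n`
      dsimp only [θ]
      split_ifs with h
      · rwa [totalDegree_X_pow]
      · rw [totalDegree_zero]
        exact Nat.zero_le _
  have hT := isVNPFamily_truncate hF hdeg
  have key : f = fun n => ∑ j ∈ range ((f n).totalDegree + 1),
      homogeneousComponent j (aeval (θ n) (g n)) := by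
    funext n
    dsimp only [θ]
    rw [truncSum_aeval_light, ← hfg n, sum_homogeneousComponent]
  rw [key]
  exact hT

/-- **`NF_ℂ ↔ B_nb`** (⟹ above; ⟸ FILE `…NbCollapseIff`): the normal form of Cor. 4.7 over `ℂ`
IS Bürgisser's GRH-conditional clause. [cite: Burgisser2024Completeness, Cor. 4.7, Thm. 4.10 (2) (p0017)] -/
theorem nbNormalForm_iff_booleanNbDefinable :
    (∀ (w : ℕ → ℕ) (f : ∀ n, MvPolynomial (Fin (w n)) ℂ), IsVNPnbFamily f →
      ∃ (a : ℕ → ℕ) (g : ∀ n, MvPolynomial (Fin (a n)) ℂ) (v : ∀ n, Fin (a n) → Fin (w n))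
        (ℓ : ∀ n, Fin (a n) → ℕ), IsVNPFamily g ∧ (IsPBounded fun n => Finset.univ.sup (ℓ n)) ∧
          ∀ n, f n = MvPolynomial.aeval (fun z => (X (v n z) : MvPolynomial (Fin (w n)) ℂ) ^
            2 ^ ℓ n z) (g n)) ↔
      VNPnbPFamSubsetVNP ℂ :=
  ⟨booleanNbDefinable_of_nbNormalForm, nbNormalForm_of_booleanNbDefinable⟩

/-- **`U_ε^Σ ↔ NF_ℂ`**: `Σ`-definability of `VNPε̄` (`PresVNPBarSubsetVNP ℂ`, FILE `…NbPresSigma`)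
is the normal form. [cite: Burgisser2024Completeness, Cor. 4.7, Thm. 4.10 (2) (p0017)]
[cite: BhargavDwivediSaxena2024, Lem. 4.1] -/
theorem presVNPBarSubsetVNP_iff_nbNormalForm :
    PresVNPBarSubsetVNP ℂ ↔
      ∀ (w : ℕ → ℕ) (f : ∀ n, MvPolynomial (Fin (w n)) ℂ), IsVNPnbFamily f →
        ∃ (a : ℕ → ℕ) (g : ∀ n, MvPolynomial (Fin (a n)) ℂ) (v : ∀ n, Fin (a n) → Fin (w n))
          (ℓ : ∀ n, Fin (a n) → ℕ), IsVNPFamily g ∧ (IsPBounded fun n => Finset.univ.sup (ℓ n)) ∧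
            ∀ n, f n = MvPolynomial.aeval (fun z => (X (v n z) : MvPolynomial (Fin (w n)) ℂ) ^
              2 ^ ℓ n z) (g n) :=
  presVNPBarSubsetVNP_iff_booleanNbDefinable.trans nbNormalForm_iff_booleanNbDefinable.symm

/-- **GRH-free skeleton of Thm. 4.10 (2), normal-form face**:
`VNPnb^ℂ ⊆ VPnb^ℂ ↔ (VP ℂ = VNP ℂ ∧ NF_ℂ)`. [cite: Burgisser2024Completeness, Cor. 4.7, Thm. 4.8, Thm. 4.10 (2) (p0017)] -/
theorem nbCollapse_iff_collapse_and_nbNormalForm :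
    (∀ (v : ℕ → ℕ) (f : ∀ n, MvPolynomial (Fin (v n)) ℂ), IsVNPnbFamily f → IsVPnbFamily f) ↔
      (VP ℂ = VNP ℂ ∧
        ∀ (w : ℕ → ℕ) (f : ∀ n, MvPolynomial (Fin (w n)) ℂ), IsVNPnbFamily f →
          ∃ (a : ℕ → ℕ) (g : ∀ n, MvPolynomial (Fin (a n)) ℂ) (v : ∀ n, Fin (a n) → Fin (w n))
            (ℓ : ∀ n, Fin (a n) → ℕ), IsVNPFamily g ∧
              (IsPBounded fun n => Finset.univ.sup (ℓ n)) ∧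
              ∀ n, f n = MvPolynomial.aeval (fun z => (X (v n z) : MvPolynomial (Fin (w n)) ℂ) ^
                2 ^ ℓ n z) (g n)) :=
  nbCollapse_iff.trans (and_congr_right fun _ => nbNormalForm_iff_booleanNbDefinable.symm)

end Summit.ValiantsHypothesis.ValiantsHypothesis.Theorems.VPBoundarySquareNbNormalFormIff

end
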